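import Summits.Ventures.PackingBounds.Energy.FivePointRieszFourN
import Summits.Ventures.PackingBounds.Configurations.FivePointConfigs
import HarnessLib

/-!
# Five points on `S²`, Riesz 4-energy: the two-sided statement

Framing: lottery ticket; floor = certified bounds/negative ranges. Venture `PackingBounds`, cell
`pub-packcert`, energy family E3PT (pub-packcert-energy gen 12).

Combines the kernel-checked sharp three-point bound `FivePointRieszFourN.riesz_four_five_points`
(`Σ_{x ≠ y} 1/(‖x-y‖²)² ≥ 91/24` for every five unit vectors of `ℝ³`, d = 6 certificate
`e3pt-sharp-n3N5s4d6-none.json`, 77×77 Gram block certified by kernel evaluation on integer data) with the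
explicit triangular bipyramid `Config.Bipyramid.pts` (inner products `-1, -1/2, 0`;
`Config.Bipyramid.energy_pts`): the minimum of the Riesz 4-energy `Σ 1/‖x-y‖⁴` of five points on `S²` is
exactly `91/24` (ordered pairs), attained by the triangular bipyramid (R. E. Schwartz, arXiv:2301.05090,
all `0 < s < 15.04…` by a computer-assisted subdivision; here by an exact SDP certificate).
-/

noncomputable section

open Finset
open scoped RealInnerProductSpace

namespace Summit.Ventures.PackingBounds.Energy.FivePointRieszFourN

open Summit.Ventures.PackingBounds.Config

/-- The triangular bipyramid has Riesz 4-energy `91/24` (ordered pairs: `2·(1/16) + 12·(1/4) + 6·(1/9)`). -/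
theorem bipyramid_riesz_four_energy :
    ∑ x ∈ Bipyramid.pts, ∑ y ∈ Bipyramid.pts.erase x, 1 / (‖x - y‖ ^ 2) ^ 2 = 91 / 24 := by
  have h : ∀ x ∈ Bipyramid.pts, ∀ y ∈ Bipyramid.pts.erase x,
      1 / (‖x - y‖ ^ 2) ^ 2 = (fun t : ℝ => 1 / (2 - 2 * t) ^ 2) (inner ℝ x y) := by
    intro x hx y hy
    have hyC : y ∈ Bipyramid.pts := Finset.mem_of_mem_erase hy
    have hn : ‖x - y‖ ^ 2 = 2 - 2 * inner ℝ x y := by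
      rw [@norm_sub_sq_real, Bipyramid.norm_pts x hx, Bipyramid.norm_pts y hyC]; ring
    simp only [hn]
  have e := Bipyramid.energy_pts (fun t : ℝ => 1 / (2 - 2 * t) ^ 2)
  rw [Finset.sum_congr rfl fun x hx => Finset.sum_congr rfl fun y hy => h x hx y hy, e]
  norm_num

/-- **Five points on `S²`, Riesz 4-energy, two-sided:** the least value of `Σ_{x ≠ y} 1/(‖x-y‖²)²`
over five unit vectors of `ℝ³` is `91/24`, attained by the triangular bipyramid. -/
theorem riesz_four_five_points_isLeast :
    IsLeast {E : ℝ | ∃ C : Finset (EuclideanSpace ℝ (Fin 3)), C.card = 5 ∧ (∀ x ∈ C, ‖x‖ = 1) ∧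
      E = ∑ x ∈ C, ∑ y ∈ C.erase x, 1 / (‖x - y‖ ^ 2) ^ 2} (91 / 24) := by
  refine ⟨⟨Bipyramid.pts, Bipyramid.card_pts, Bipyramid.norm_pts, bipyramid_riesz_four_energy.symm⟩, ?_⟩
  rintro E ⟨C, h5, hC, rfl⟩
  exact riesz_four_five_points C hC h5

end Summit.Ventures.PackingBounds.Energy.FivePointRieszFourN
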